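import Literature.AnabelianGeometry.SemiGraphs.TemperedVerticial
import HarnessLib

/-!
# A constructor for quasi-coherence ([SemiAnbd] Def. 2.3 (iii)) from compatible open normal levels

Mochizuki, *Semi-graphs of anabelioids*, Publ. RIMS **42** (2006), §2, Def. 2.3 (i)–(iii), manuscript
pp. 24–25 [cite: MochizukiSemiAnbd2006, Def 2.3 pp.24-25]: an *approximator* of `G` is a semi-graph of
finite groups of injective type and bounded order on the same underlying semi-graph receiving `G`; `G` is
*quasi-coherent* if for every `M` some approximator's kernels act trivially on all the given finite
étale coverings of degree `≤ M` of the constituents.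

PROOF-ONLY file (abc-iut cell, FRONTIER programme SUBDAG-REFUTE-F1732, brick R4 piece (C-generic), seat
abc-iut-w4-d075; theorems only, no definition).  `isQuasiCoherent_of_compatibleLevels`: SUPPOSE that for
every bound `M` one is given open normal subgroups `U_M(v) ⊴ Π_v`, `W_M(e) ⊴ Π_e` of finite index, the
vertex indices bounded uniformly in `v`, such that (a) every branch map `b_* : Π_e → Π_v` pulls `U_M(v)`
back to EXACTLY `W_M(e)` and (b) `U_M(v)`, `W_M(e)` fix pointwise every finite continuous `Π_v`-, resp.
`Π_e`-set with at most `M` points; THEN `G` is quasi-coherent (`ProfiniteSemiGraph.IsQuasiCoherent`):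
the approximator is `Π_v/U_M(v)`, `Π_e/W_M(e)` with the INDUCED (injective, by (a)) branch maps, the
2-cells trivial, bounded order `B!`.  Condition (b) is what the characteristic open cores
`charOpenCore Π_c M` satisfy (`CharacteristicOpenCore.lean`); condition (a) is where a concrete semi-graph
must do work (for the countermodel `𝒢_θ` of the programme: ONE characteristic open subgroup of the
common vertex group, preserved by the gluing automorphisms).  Nothing here refers to the IUT corpus or
takes a side on [IUTchIII] Cor. 3.12.
-/

namespace Literature.AnabelianGeometry.SemiGraphs

open Topology

universe u

namespace ProfiniteSemiGraph

variable {𝒢 : ProfiniteSemiGraph.{u}}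

/-- **Quasi-coherence from compatible open normal levels** ([SemiAnbd] Def. 2.3 (iii)): see the module
docstring.  The data are indexed by the bound `M`; at each `M` the approximator `G → G'_M` has
`π̂₁(G'_v) = Π_v/U_M(v)`, `π̂₁(G'_e) = Π_e/W_M(e)`. [cite: MochizukiSemiAnbd2006, Def 2.3(iii) p.25] -/
theorem isQuasiCoherent_of_compatibleLevels
    (U : ℕ → ∀ v : 𝒢.graph.Vertex, Subgroup (𝒢.Gv v))
    (W : ℕ → ∀ e : 𝒢.graph.Edge, Subgroup (𝒢.Ge e))
    (hUn : ∀ M v, (U M v).Normal) (hWn : ∀ M e, (W M e).Normal)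
    (hUo : ∀ M v, IsOpen (U M v : Set (𝒢.Gv v))) (hWo : ∀ M e, IsOpen (W M e : Set (𝒢.Ge e)))
    (hUi : ∀ M, ∃ B : ℕ, ∀ v, (U M v).index ≠ 0 ∧ (U M v).index ≤ B)
    (hWi : ∀ M e, (W M e).index ≠ 0)
    (hcomp : ∀ M (b : 𝒢.graph.Branch) (v : 𝒢.graph.Vertex) (h : 𝒢.graph.abuts b = some v),
      (U M v).comap (𝒢.brHom b v h).toMonoidHom = W M (𝒢.graph.edgeOf b))
    (hUfix : ∀ M v (X : BTemp (𝒢.Gv v)), Finite X.obj.V → Nat.card X.obj.V ≤ M →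
      ∀ g ∈ U M v, ∀ x : X.obj.V, X.obj.ρ g x = x)
    (hWfix : ∀ M e (X : BTemp (𝒢.Ge e)), Finite X.obj.V → Nat.card X.obj.V ≤ M →
      ∀ g ∈ W M e, ∀ x : X.obj.V, X.obj.ρ g x = x) :
    𝒢.IsQuasiCoherent := by
  intro M HV HE hHV hHE
  obtain ⟨B, hB⟩ := hUi M
  haveI : ∀ v, (U M v).Normal := fun v => hUn M v
  haveI : ∀ e, (W M e).Normal := fun e => hWn M e
  haveI : ∀ v, (U M v).FiniteIndex := fun v => ⟨(hB v).1⟩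
  haveI : ∀ e, (W M e).FiniteIndex := fun e => ⟨hWi M e⟩
  have hle : ∀ (b : 𝒢.graph.Branch) (v : 𝒢.graph.Vertex) (h : 𝒢.graph.abuts b = some v),
      W M (𝒢.graph.edgeOf b) ≤ (U M v).comap (𝒢.brHom b v h).toMonoidHom :=
    fun b v h => (hcomp M b v h).ge
  -- the approximator `Π_v/U_M(v)`, `Π_e/W_M(e)`
  let A : 𝒢.Approximator :=
    { FV := fun v => 𝒢.Gv v ⧸ U M v
      FE := fun e => 𝒢.Ge e ⧸ W M e
      πV := fun v => QuotientGroup.mk' (U M v)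
      πE := fun e => QuotientGroup.mk' (W M e)
      isOpen_ker_πV := fun v => by rw [QuotientGroup.ker_mk']; exact hUo M v
      isOpen_ker_πE := fun e => by rw [QuotientGroup.ker_mk']; exact hWo M e
      brF := fun b v h =>
        QuotientGroup.map (W M (𝒢.graph.edgeOf b)) (U M v) (𝒢.brHom b v h).toMonoidHom (hle b v h)
      brF_injective := fun b v h => by
        rw [injective_iff_map_eq_one]
        intro a ha
        obtain ⟨g, rfl⟩ := QuotientGroup.mk_surjective a
        rw [QuotientGroup.map_mk, QuotientGroup.eq_one_iff] at ha
        rw [QuotientGroup.eq_one_iff, ← hcomp M b v h]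
        exact ha
      comm := fun b v h => ⟨1, fun x => by
        rw [one_mul, inv_one, mul_one]
        rfl⟩
      bounded := ⟨B.factorial, Nat.factorial_pos B, fun v =>
        Nat.dvd_factorial (Nat.pos_of_ne_zero (hB v).1) (hB v).2⟩ }
  refine ⟨A, fun v g hg x => ?_, fun e g hg x => ?_⟩
  · have hgU : g ∈ U M v := (QuotientGroup.eq_one_iff g).mp hg
    exact hUfix M v (HV v) (hHV v).2 (hHV v).1 g hgU x
  · have hgW : g ∈ W M e := (QuotientGroup.eq_one_iff g).mp hg
    exact hWfix M e (HE e) (hHE e).2 (hHE e).1 g hgW x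

/-- The same constructor with the level families CONSTANT in `M` replaced by «one level per bound»
read through a bound-to-level function — convenience re-indexing: if levels `U' n`, `W' n` (`n : ℕ`)
satisfy the hypotheses at the bounds `M` with `n = ℓ M`, quasi-coherence follows.
[cite: MochizukiSemiAnbd2006, Def 2.3(iii) p.25] -/
theorem isQuasiCoherent_of_compatibleLevels' (ℓ : ℕ → ℕ)
    (U' : ℕ → ∀ v : 𝒢.graph.Vertex, Subgroup (𝒢.Gv v))
    (W' : ℕ → ∀ e : 𝒢.graph.Edge, Subgroup (𝒢.Ge e))
    (hUn : ∀ n v, (U' n v).Normal) (hWn : ∀ n e, (W' n e).Normal)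
    (hUo : ∀ n v, IsOpen (U' n v : Set (𝒢.Gv v))) (hWo : ∀ n e, IsOpen (W' n e : Set (𝒢.Ge e)))
    (hUi : ∀ n, ∃ B : ℕ, ∀ v, (U' n v).index ≠ 0 ∧ (U' n v).index ≤ B)
    (hWi : ∀ n e, (W' n e).index ≠ 0)
    (hcomp : ∀ n (b : 𝒢.graph.Branch) (v : 𝒢.graph.Vertex) (h : 𝒢.graph.abuts b = some v),
      (U' n v).comap (𝒢.brHom b v h).toMonoidHom = W' n (𝒢.graph.edgeOf b))
    (hUfix : ∀ M v (X : BTemp (𝒢.Gv v)), Finite X.obj.V → Nat.card X.obj.V ≤ M →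
      ∀ g ∈ U' (ℓ M) v, ∀ x : X.obj.V, X.obj.ρ g x = x)
    (hWfix : ∀ M e (X : BTemp (𝒢.Ge e)), Finite X.obj.V → Nat.card X.obj.V ≤ M →
      ∀ g ∈ W' (ℓ M) e, ∀ x : X.obj.V, X.obj.ρ g x = x) :
    𝒢.IsQuasiCoherent :=
  isQuasiCoherent_of_compatibleLevels (fun M => U' (ℓ M)) (fun M => W' (ℓ M))
    (fun M => hUn (ℓ M)) (fun M => hWn (ℓ M)) (fun M => hUo (ℓ M)) (fun M => hWo (ℓ M))
    (fun M => hUi (ℓ M)) (fun M => hWi (ℓ M)) (fun M => hcomp (ℓ M)) hUfix hWfix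

end ProfiniteSemiGraph

end Literature.AnabelianGeometry.SemiGraphs
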